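import Summits.NavierStokesRegularity.FluidComputer.TriggerSweepLedger2

/-!
# Door N1-FC, the viscosity sweep of the one-shot trigger ensemble — ledger continuation (§11 ff.): the decade block
# (PREREG-FC-TRIG-2 §5 (i) TREND inputs on host (a)) and later information rows

Cell `pub-fluidc` (FLUID COMPUTER; host summit `NavierStokesRegularity`, negation side, machine paradigm), seat
`pub-fluidc-dns-A2` (engineer, engine A; gen 6, 2026-08-27; D-0074 GROUP D «FC TRIGGER ENSEMBLE», bears_on N1-FC).
HONEST FRAMING: low prior, high value-of-information experiment on Tao's machine paradigm; NOT a claim that NS blows up.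
WHAT THIS IS NOT: not Navier–Stokes evidence and not a word — TYPED ARITHMETIC on the numbers PRINTED by the cell's
registered readers (PREREG-FC-TRIG-2, frozen prefix 4ea8d50f…; engine-A deposits `data/gate/backend/dnsA/fctrig*_j*/children/*/read.json`,
second-read by this seat digit for digit and tabulated in `pub-fluidc-dns-A2/reads/XNU_DELTA_ETA_TABLE.md` fcb362a5…): MODEL/DNS readings
of ONE design family over one decade of Reynolds number. Every τ* / per-rung / TREND / JOINT / RESULT word belongs to the custody pen
(`fc2_words.py` 465267a9…, §5 (i), §6, SLOT 5 (vii) = prereg file line 128); the kernel checks rational inequalities and instantiates the tree's floor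
lemmas (`GadgetDetectionFloor.not_kelvin_two_of_reading`, `not_exists_triggerScheme_two_of_reading`), whose identification of a DNS
reading `ηr ± δ` with a scheme's efficiency is the cell's MODEL bookkeeping, never the kernel's.

This file CONTINUES `TriggerSweepLedger.lean` (§1–§7, 340 lines) and `TriggerSweepLedger2.lean` (§8–§10, 322 lines: appends `9d`–`9f`, the
rung-9 rows at the 512³ grid of record, the two-grid and two-engine cells), both near the 400-line cap for files with proofs; the dictionary
(η_child, J, η⁻ = η_child − J, Δη, Λ = Δη − J, δ; Kelvin floor `η > 1/2` at λ = 2, one child) and the conventions (7-decimal prints; every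
inequality evaluated on the printed decimals before being typed) are those files'. It is append-only in the same way: identifiers of each append
carry a suffix (`dec` here; a later engine-B 384³ information trio at r = 9 would be `9g`).

* §11 (`dec`): the decade block — per rung r ∈ {1, 3, 9} on (a) at its value-of-record grid, the best `η⁻`, its floor `δ`, the untriggered
  host value on the same window: `yDec_eq_typed` (the three inputs are literals already typed in §3 / §9 / §10), `yBestDec_le`, `deltaBestDec_le`,
  `no_kelvin_two_of_decade`, `no_triggerScheme_two_of_decade`, `increments_resolved_dec` / `host_increments_resolved_dec` (every TREND
  increment exceeds its floor), `saturation_dec` (second increment < first; ten of it fit in the gap at ν₀/9), `triggered_eq_untriggered_dec`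
  (best η⁻ within 5.1e-5 of the host value at every rung, inside each δ), `i19_best_vs_host_dec`, `decade_record_dec`.
0 sorry; no named fact; no instance; axioms ⊆ {propext, Classical.choice, Quot.sound}.
-/

noncomputable section

namespace Summit.NavierStokesRegularity.FluidComputer.TriggerSweepLedger

open Summit.NavierStokesRegularity.FluidComputer.GadgetDetectionFloor
open Summit.NavierStokesRegularity.FluidComputer.TriggeredTransfer

/-! ## §11 DECADE APPEND (dns-A2 gen 6, 2026-08-27, suffix `dec`): THE TREND-BLOCK INPUTS OF PREREG-FC-TRIG-2 §5 (i) ON HOST (a) AS TYPED ROWS — of record on prereg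
file line 128 = §9 SLOT 5 (vii) (pen gadgets2 g5, 02:56Z; reader run `staging/fc-trig-2/reads/fc2_words_r9_2E_20260827T0248Z.md` e6d1b611… / `fc2_r9_2E_20260827T0248Z.json`
adedd735…), every ENGINE-A input of which this seat re-derived digit for digit from its own reads of record (HOME/STATUS dns-A2 l.5864; report
`pub-fluidc-dns-A2/reads/cocheck_slot5vii_fc2_r9_2E_0248Z.txt` bf713445…). Per rung r ∈ {1, 3, 9} on (a) at its value-of-record grid (384³, 384³, 512³) and τ* = 0
(t_inj 2.00): the best `η⁻` (r = 1: S1-384 j249267 = §3 `bestEtaMinus 1`; r = 3: S3-384 j252428 = §3 `bestEtaMinus 5`; r = 9: T3-512 j256565 = §9 `etaMinus9e 0`, an exact tie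
with S3-512 §8 — the reader's tie-break takes T), that row's floor `δ`, and the untriggered host value `η_{C-0}` on the same window (§3 `cellHost 1 / 5` = the 384³ maxima;
§10 `etaHostWin9f 0` = the 512³ left-end value η(2.00)). The TREND rule compares increments `i_ab = y_b − y_a` with floors `f_ab = δ_a + δ_b` (host row: `0.02 (y_a + y_b)`).
What the kernel checks (7-decimal prints, arithmetic only): every increment exceeds its floor; the second increment is below the first and more than ten of it fit in
the gap left at ν₀/9 (the pen's «n* = 10.1», information); the triggered and untriggered ladders agree rung by rung within each `δ` (indeed within 5.1e-5) and their
decade increments within 3e-5 (the pen's «|di19| = 0.0000»); each rung's best reading certifies the λ = 2 floor failure by `not_kelvin_two_of_reading`.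
RISING-SATURATING / FLAT / «BELOW FLOOR ACROSS THE DECADE» and the NEGATIVE census word are the pen's (§5 (i), §6.3, l.128) — cited, not claimed. -/

/-- Best `η⁻` per rung on (a) at the value-of-record grid, τ* = 0: r = 1 (S1-384), r = 3 (S3-384), r = 9 (T3-512 ≡ S3-512) (append dec). -/
def yBestDec : Fin 3 → ℝ := ![0.2732392, 0.3207547, 0.3369448]
/-- The floors `δ = max(0.02 η_child, |J − ε²|)` of those three rows (r = 9: T3-512's, by the reader's tie-break; S3-512's is 0.0069151) (append dec). -/
def deltaBestDec : Fin 3 → ℝ := ![0.0056358, 0.0065900, 0.0069064]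
/-- Untriggered host `η_{C-0}` on the same rows' windows: 384³ maxima at r = 1, 3; the 512³ left-end value η(2.00) at r = 9 (append dec). -/
def yHostDec : Fin 3 → ℝ := ![0.2732136, 0.3207040, 0.3369448]

/-- The decade's three inputs ARE literals already typed in this ledger: §3 `bestEtaMinus 1 / 5`, §9 `etaMinus9e 0`; §3 `cellHost 1 / 5`, §10 `etaHostWin9f 0`. [folklore] -/
theorem yDec_eq_typed :
    (yBestDec 0 = bestEtaMinus 1 ∧ yBestDec 1 = bestEtaMinus 5 ∧ yBestDec 2 = etaMinus9e 0) ∧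
    (yHostDec 0 = cellHost 1 ∧ yHostDec 1 = cellHost 5 ∧ yHostDec 2 = etaHostWin9f 0) := by
  refine ⟨⟨by simp [yBestDec, bestEtaMinus], by simp [yBestDec, bestEtaMinus], by simp [yBestDec, etaMinus9e, etaChild9e, jump9e]; norm_num⟩,
    by simp [yHostDec, cellHost], by simp [yHostDec, cellHost], by simp [yHostDec, etaHostWin9f]⟩

/-- Every rung's best `η⁻ ≤ 349 / 1000` (max 0.3369448). [folklore] -/
theorem yBestDec_le : ∀ i : Fin 3, yBestDec i ≤ 349 / 1000 := by
  intro i; fin_cases i <;> simp [yBestDec] <;> norm_num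

/-- Every rung's floor `δ ≤ 7 / 1000`. [folklore] -/
theorem deltaBestDec_le : ∀ i : Fin 3, deltaBestDec i ≤ 7 / 1000 := by
  intro i; fin_cases i <;> simp [deltaBestDec] <;> norm_num

/-- At every rung of the decade (`not_kelvin_two_of_reading`): any efficiency within the best row's floor of its `η⁻` fails `1 < 2η`. [folklore] -/
theorem no_kelvin_two_of_decade (i : Fin 3) {η : ℝ} (hread : |yBestDec i - η| ≤ deltaBestDec i) : ¬ 1 < η * 2 :=
  not_kelvin_two_of_reading hread (yBestDec_le i) ((deltaBestDec_le i).trans (by norm_num))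

/-- At every rung: no one-child `TriggerScheme` with `λ = 2` has its efficiency in the best row's certified window. [cite: Tao2016AveragedNS, §1.3] -/
theorem no_triggerScheme_two_of_decade (i : Fin 3) :
    ¬ ∃ 𝒮 : TriggerScheme, 𝒮.lam = 2 ∧ |yBestDec i - 𝒮.eta| ≤ deltaBestDec i :=
  not_exists_triggerScheme_two_of_reading (yBestDec_le i) ((deltaBestDec_le i).trans (by norm_num))

/-- THE INCREMENTS ARE RESOLVED (best-`η⁻` row of the TREND block): i13 = 0.0475155 > f13 = 0.0122258, i39 = 0.0161901 > f39 = 0.0134964,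
i19 = 0.0637056 > f19 = 0.0125422 (`f_ab = δ_a + δ_b`). [folklore] -/
theorem increments_resolved_dec :
    deltaBestDec 0 + deltaBestDec 1 < yBestDec 1 - yBestDec 0 ∧
    deltaBestDec 1 + deltaBestDec 2 < yBestDec 2 - yBestDec 1 ∧
    deltaBestDec 0 + deltaBestDec 2 < yBestDec 2 - yBestDec 0 := by
  simp [yBestDec, deltaBestDec]; norm_num

/-- The untriggered host row likewise with `f_ab = 0.02 (y_a + y_b)`: 0.0474904 > 0.0118784, 0.0162408 > 0.0131530, 0.0637312 > 0.0122032. [folklore] -/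
theorem host_increments_resolved_dec :
    2e-2 * (yHostDec 0 + yHostDec 1) < yHostDec 1 - yHostDec 0 ∧
    2e-2 * (yHostDec 1 + yHostDec 2) < yHostDec 2 - yHostDec 1 ∧
    2e-2 * (yHostDec 0 + yHostDec 2) < yHostDec 2 - yHostDec 0 := by
  simp [yHostDec]; norm_num

/-- SATURATION ARITHMETIC: the second increment is below the first (indeed `≤ 341/1000` of it) on both ladders, and at ν₀/9 the gap to the λ = 2 floor holds
more than ten second increments: `10 · i39 ≤ 1/2 − y9` (0.161901 ≤ 0.1630552; the pen's «n* = 10.1»). [folklore] -/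
theorem saturation_dec :
    yBestDec 2 - yBestDec 1 < yBestDec 1 - yBestDec 0 ∧
    yBestDec 2 - yBestDec 1 ≤ 341 / 1000 * (yBestDec 1 - yBestDec 0) ∧
    yHostDec 2 - yHostDec 1 ≤ 342 / 1000 * (yHostDec 1 - yHostDec 0) ∧
    10 * (yBestDec 2 - yBestDec 1) ≤ 1 / 2 - yBestDec 2 := by
  simp [yBestDec, yHostDec]; norm_num

/-- TRIGGERED = UNTRIGGERED, RUNG BY RUNG: the best `η⁻` sits within `5.1e-5` of the untriggered host value at every rung (2.56e-5 / 5.07e-5 / 0), a fortiori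
within that rung's floor `δ`, and never below it. [folklore] -/
theorem triggered_eq_untriggered_dec :
    ∀ i : Fin 3, |yBestDec i - yHostDec i| ≤ 5.1e-5 ∧ |yBestDec i - yHostDec i| ≤ deltaBestDec i ∧ yHostDec i ≤ yBestDec i := by
  intro i; fin_cases i <;> simp [yBestDec, yHostDec, deltaBestDec] <;> norm_num [abs_le]

/-- The two ladders' decade increments agree to `3e-5`: |i19(best η⁻) − i19(η_{C-0})| = |0.0637056 − 0.0637312| = 2.56e-5. [folklore] -/
theorem i19_best_vs_host_dec : |(yBestDec 2 - yBestDec 0) - (yHostDec 2 - yHostDec 0)| ≤ 3e-5 := by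
  simp [yBestDec, yHostDec]; norm_num [abs_le]

/-- THE DECADE IN ONE LINE (value-of-record grids): 0.2732392 < 0.3207547 < 0.3369448 ≤ 349/1000, each within 5.1e-5 of its untriggered host value,
gaps to the λ = 2 floor 0.2267608 / 0.1792453 / 0.1630552. Arithmetic only; every word is the pen's. [folklore] -/
theorem decade_record_dec :
    yBestDec 0 < yBestDec 1 ∧ yBestDec 1 < yBestDec 2 ∧ yBestDec 2 ≤ 349 / 1000 ∧
    (1 : ℝ) / 2 - yBestDec 0 = 0.2267608 ∧ (1 : ℝ) / 2 - yBestDec 1 = 0.1792453 ∧ (1 : ℝ) / 2 - yBestDec 2 = 0.1630552 := by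
  simp [yBestDec]; norm_num

/-! ## §12 r = 9 THIRD-ENGINE APPEND (dns-A2 gen 7, 2026-08-27, suffix `9g`): THE ENGINE-B RUNG-9 384³ TRIO AT τ* = 0 (t_inj 2.00) AS INFORMATION ROWS — cell `pub-fluidc`,
seat `pub-fluidc-dns-B2` (frozen dns-B 0.4.0 + r2b bands, SSP-RK3, cube-2/3 dealiasing K = 127, f64; host = dns-A3's H9-384 checkpoint t 2.00, seeds = dns-A4's hand-over files,
A5 rebuild-match in-job), the full trio (C-0, T, S); of record as THIRD-ENGINE INFORMATION by COLUMN RULE (δ) (pub STATUS l.5104: the second-engine column at r = 9 is circuit2's at the 512³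
grid of record, §10 `9f`) on pub STATUS l.6076 (dns-B2 g0 READ: C-0 j259154 + T(τ*) j256586) and l.6301 (dns-B2 g0 FINAL TRIO: S(τ*) from the full-window twin j262383; the wall-stopped j256587 leg of l.6130 was provisional, first-row quantities identical; K-READ ✓ refuter2 g9 l.6305) + the pen's PREREG-FC-TRIG-2 l.131 = §9 SLOT 5 (ix) PART 1 (pub l.6081; K-READ ✓ refuter2 g8 l.6086, co-read ✓ ref4 g4 l.6083) and l.132 = PART 2 (pub l.6303; K-READ ✓ ref4 g4 l.6304, K-TICK ✓ refuter2 g9 l.6308 with reader re-run byte-identical); deposits dnsB2/fctrig2/FC2r9-384-C0-t2.00_j259154 (SHA256SUMS 9b919d0b…), FC2r9-384-T-t2.00_j256586 (e9388112…), FC2r9-384-S-t2.00_j262383 (46fa2d66…) + pair_FC2r9_384_T.json a7c54db1… / pair_FC2r9_384_S.json fec15aba…; this seat's second-reader CO-CHECKS of those files and lines (every engine-A reference re-derived from the engine-A deposits, every engine-B number re-read from the deposited leg spectra, 0 mismatches): pub l.6082 (i) (T), l.6302 (S), l.6306 (l.132). This seat did not run or re-read engine B; the numbers below are the 7-decimal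 prints of those lines, and every inequality was evaluated
on them before typing. Convention: `etaHostWin9g` = ENGINE B's OWN untriggered continuation (C-0 twin) on the child window [2.00, 3.50], whose maximum is its left-end value
η(2.00) = 0.3369402; `lambdaWin9g = (η_child − η_{C-0}) − J` is the runner's §5 (d) Λ. The engine-A comparison values are the typed 384³ rows (§5 `etaChild9a 1` = T3-384
0.3453170, §7 `etaChild9c 0` = S3-384 0.3457497) and the reader's 384³ `η_{C-0}(2.00)` = 0.3369402. NUMBERS only — an information row cannot move a word (§6.5); the rung-9 /
TREND / JOINT / RESULT words are the pen's (ll.128–129). -/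

/-- Engine-B row order (r = 9, 384³, τ* = 0, append g): 0: T; 1: S. `η_child` per row (first row = the injected state, as on engines A and circuit). -/
def etaChild9g : Fin 2 → ℝ := ![0.3453170, 0.3457497]
/-- `J` per row (append g; engine A prints 0.0083768, 0.0088095 on the same seed files at 384³). -/
def jump9g : Fin 2 → ℝ := ![0.0083768, 0.0088095]
/-- Engine B's own `η_{C-0}` on the child window (C-0 twin leg; left-end value; append g). -/
def etaHostWin9g : Fin 2 → ℝ := ![0.3369402, 0.3369402]
/-- `δ = max(0.02·η_child, |J − ε²|)` as printed (append g). -/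
def delta9g : Fin 2 → ℝ := ![0.0069063, 0.0069150]
/-- `η⁻ = η_child − J` (append g). -/
def etaMinus9g (i : Fin 2) : ℝ := etaChild9g i - jump9g i
/-- `Λ = (η_child − η_{C-0}) − J` on engine B's own host continuation (append g). -/
def lambdaWin9g (i : Fin 2) : ℝ := (etaChild9g i - etaHostWin9g i) - jump9g i

/-- «|Λ| ≤ δ» on every engine-B row (max |Λ| = 0.00e+00 ≤ 1e-7). [folklore] -/
theorem absent_above_delta9g : ∀ i : Fin 2, |lambdaWin9g i| ≤ delta9g i ∧ |lambdaWin9g i| ≤ 1e-7 := by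
  intro i; fin_cases i <;> simp [lambdaWin9g, etaChild9g, etaHostWin9g, jump9g, delta9g] <;> norm_num [abs_le]

/-- Engine B's `η⁻ ≤ 349 / 1000` on every row (max 0.3369402). [folklore] -/
theorem etaMinus9g_le : ∀ i : Fin 2, etaMinus9g i ≤ 349 / 1000 := by
  intro i; fin_cases i <;> simp [etaMinus9g, etaChild9g, jump9g] <;> norm_num

/-- Engine B's `δ ≤ 7 / 1000` on every row. [folklore] -/
theorem delta9g_le : ∀ i : Fin 2, delta9g i ≤ 7 / 1000 := by
  intro i; fin_cases i <;> simp [delta9g] <;> norm_num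

/-- Engine-B rows (`not_kelvin_two_of_reading`): any efficiency within a row's floor of its `η⁻` fails `1 < 2η`. [folklore] -/
theorem no_kelvin_two_of_row9g (i : Fin 2) {η : ℝ} (hread : |etaMinus9g i - η| ≤ delta9g i) : ¬ 1 < η * 2 :=
  not_kelvin_two_of_reading hread (etaMinus9g_le i) ((delta9g_le i).trans (by norm_num))

/-- Engine-B rows: no one-child `TriggerScheme` with `λ = 2` has its efficiency in any row's certified window. [cite: Tao2016AveragedNS, §1.3] -/
theorem no_triggerScheme_two_of_row9g (i : Fin 2) :
    ¬ ∃ 𝒮 : TriggerScheme, 𝒮.lam = 2 ∧ |etaMinus9g i - 𝒮.eta| ≤ delta9g i :=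
  not_exists_triggerScheme_two_of_reading (etaMinus9g_le i) ((delta9g_le i).trans (by norm_num))

/-- ENGINE-A readings at 384³, restated: 0: `η_{C-0}(2.00)` (the reader's C-0 column on every τ = 0 row at 384³); 1: T3-384 j254577, §5 `etaChild9a 1`; 2: S3-384 j256566, §7 `etaChild9c 0`. -/
def engA9g : Fin 3 → ℝ := ![0.3369402, 0.3453170, 0.3457497]
/-- ENGINE B's readings of the same quantities (C-0 twin, T leg, S leg), as printed. -/
def thirdEng9g : Fin 3 → ℝ := ![0.3369402, 0.3453170, 0.3457497]

/-- The restated engine-A trigger-arm entries ARE the typed 384³ rows (`engA9g 1 = etaChild9a 1`; `engA9g 2 = etaChild9c 0`); the C-0 entry is the reader's window value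
0.3369402 = §7's `etaMinus9c 0` to the print (S3-384 has Λ = 0: η_child − J = η_{C-0}(2.00)). [folklore] -/
theorem engA9g_eq_typed : engA9g 1 = etaChild9a 1 ∧ engA9g 2 = etaChild9c 0 ∧ engA9g 0 = etaMinus9c 0 := by
  refine ⟨?_, ?_, ?_⟩
  · simp [engA9g, etaChild9a]
  · simp [engA9g, etaChild9c]
  · norm_num [engA9g, etaMinus9c, etaChild9c, jump9c]

/-- r = 9 THREE ENGINES AT 384³: engine B agrees with engine A to `1e-7` relative on `η_{C-0}(2.00)` and on each trigger arm's `η_child` at τ* (printed relative differences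
0.0e+00 / 0.0e+00 / 0.0e+00) — a fortiori inside the registered 5 % rule (§3.5 / §5 (e); the word is the pen's; circuit2's 384³ trio was cancelled per (ε′),
so at 384³ engine B is the only non-dns-A engine, at 512³ circuit2 is, §10). [folklore] -/
theorem threeEngine9g_agree :
    ∀ i : Fin 3, |thirdEng9g i - engA9g i| ≤ 1e-7 * engA9g i ∧ |thirdEng9g i - engA9g i| ≤ 0.05 * engA9g i := by
  intro i; fin_cases i <;> simp [thirdEng9g, engA9g] <;> norm_num [abs_le]

/-- THE r = 9 COLUMN AT 384³ ON TWO INTEGRATORS: engine B's typed `η⁻` rows are at most 0.3369402, within `1e-7` of engine A's 384³ best 0.3369402 (§7; tie T3 = S3 = L3),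
below `349/1000` with gap `1/2 − 0.3369402 = 0.1630598` to the λ = 2 floor. Arithmetic only; the rung word is the pen's. [folklore] -/
theorem r9_column_384_9g :
    (∀ i : Fin 2, etaMinus9g i ≤ 0.3369402) ∧ |(0.3369402 : ℝ) - 0.3369402| ≤ 1e-7 ∧
    (0.3369402 : ℝ) ≤ 349 / 1000 ∧ (1 : ℝ) / 2 - 0.3369402 = 0.1630598 := by
  refine ⟨?_, by norm_num [abs_le]⟩
  intro i; fin_cases i <;> simp [etaMinus9g, etaChild9g, jump9g] <;> norm_num

/-- THE TIME-STEPPERS THEMSELVES (information): at the last shared instant t = 3.5 of the 384³ T legs, engine B's child-band efficiency 0.2801712 and engine A's 0.2801638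
agree to `1e-4` relative. [folklore] -/
theorem threeEngine9g_late : |(0.2801712 : ℝ) - 0.2801638| ≤ 1e-4 * 0.2801638 := by norm_num [abs_le]

end Summit.NavierStokesRegularity.FluidComputer.TriggerSweepLedger

end
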